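import Mathlib
import Summits.PneNP.PneNP.Theorems.KrwChromaticSteeringStrongCompositionLrbDefs
import Summits.PneNP.PneNP.Theorems.KrwChromaticSteeringStrongCompositionLradJointExistence
import Literature.Computability.Complexity.KWDepthHardFunctions

/-!
# Route KrwChromaticSteering, crux `StrongComposition` (stmt-PneNP-18538), line `lrb-gluing`: S0⁺ PROVED —
# one inner function that is affinely generic AND subspace-hard (registered stub `stub_jointSubspaceHard`)

THEOREM (`stub_jointSubspaceHard : jointSubspaceHard_exists`, constant `c = 3`).  For every `n` with `3 (log₂ n + 1) + 1 ≤ n`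
there is ONE `g : {0,1}^n → {0,1}` which is `r`-affine-generic, `r = 3 (log₂ n + 1)` (inside every satisfiable system of
`≤ n − r − 1` parity equations `g` takes both values, `KrwLrad.AffGeneric`) AND subspace-hard with budget `q = n − r − 1`
(`KrwLrb.SubspaceHard`: on the solution set of every satisfiable system of `k ≤ q` parity equations the Karchmer–Wigderson game
of `g`, answers = ambient coordinates, needs depth `≥ q − k`).  This is the support statement S0⁺ of the skeleton
`Cruxes/StrongComposition/Lines/lrb_gluing.lean` (its other stub, `stub_lrbQuantitative`, is the load-bearing one).

PROOF (Riordan–Shannon counting through the easy direction of Karchmer–Wigderson; Jukna, *Boolean Function Complexity*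
(2012), Thm. 1.23 and Thm. 3.13 / Claim 3.15, in the tree as `CircuitCount.card_code_le` and
`KWTree.exists_cktSize_of_rectangle`).  ONE bad set: `g` is bad if for some `k ≤ q`, some system `σ` of `k` equations with a
solution, and some CODE `c` of a `B₂`-circuit of size `≤ 2^{q−k}` (`CircuitCount.Code n (2^{q−k})`), `g` agrees with the
decoding of `c` on the solution set of `σ`.
* §1 a satisfiable system of `k` equations has `≥ 2^{n−k}` solutions (`KrwLrad.two_pow_le_card_sol`, imported from the line
  `lrad-gluing`'s S0 file), and the functions agreeing with a fixed `h` on a set `T` number `≤ 2^{2^n − |T|}`; §2 `#Code(n,S) ≤ 2^{(2n+4)(S+1)}` once `n + S + 1 ≤ 2^n`, constants are codes of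
  every size `≥ 1`, and a protocol of depth `d` solving an inhabited rectangle is separated by a code of any size `≥ 2^{d+1} − 1`;
* §3 hence level `k` of the bad set has `≤ 2^{(n+1)k} · 2^{(2n+4)(2^{q−k}+1)} · 2^{2^n − 2^{n−k}} ≤ 2^{2^n − n − 1}` elements by
  the key inequality `(n+1) k + (2n+4)(2^{q−k} + 1) + n + 1 ≤ 2^{n−k}` (§4, from `(n+1)(n+2) + 2 ≤ 2^{2 log₂ n + 3}` and
  `n − k ≥ (q − k) + 2 log₂ n + 4`), and the `q + 1 ≤ n < 2^{n+1}` levels together miss some `g` (`exists_subspaceGood`);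
* §5 a good `g` is affine-generic (a constant value on `Sol E` is agreement with a size-`1` code) and subspace-hard (a protocol of
  depth `< q − k` on `(Sol F ∩ g⁻¹1) × (Sol F ∩ g⁻¹0)` — both sides inhabited by genericity, as `k < q` — is a code of size
  `≤ 2^{q−k} − 1` agreeing with `g` on `Sol F`).
All counting is over explicit `Finset`s (no new definitions).  Honest framing: elementary support lemma of a FRONTIER rung
(class-restricted strong composition); C1 stays open and nothing here bears on P vs NP.
-/

set_option linter.dupNamespace false -- `Summit.PneNP.PneNP.…`: summit = sub-problem name (D-0017 single-conjunct layout)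
set_option autoImplicit false

namespace Summit.PneNP.PneNP.Theorems.KrwLrb

open Literature.Computability.Complexity
open Summit.PneNP.PneNP.Theorems.KrwLrad

variable {n : ℕ}

/-! ## §1 Functions agreeing on a set (the solution count `two_pow_le_card_sol` is imported from the line
`lrad-gluing`'s `…LradJointExistence`) -/

/-- Boolean functions on `{0,1}^n` that agree with a fixed `h` on `T` number at most `2^{2^n − |T|}`
(they are determined by their restriction to the complement of `T`). -/
theorem card_agreeOn_le (T : Finset (Fin n → Bool)) (h : (Fin n → Bool) → Bool) :
    (Finset.univ.filter fun g : (Fin n → Bool) → Bool => ∀ x ∈ T, g x = h x).card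
      ≤ 2 ^ (2 ^ n - T.card) := by
  have hc : Fintype.card ({x : Fin n → Bool // x ∉ T} → Bool) = 2 ^ (2 ^ n - T.card) := by
    rw [Fintype.card_fun, Fintype.card_bool, Fintype.card_subtype_compl, Fintype.card_coe]
    simp [Fintype.card_bool, Fintype.card_fin]
  rw [← hc, ← Finset.card_univ]
  apply Finset.card_le_card_of_injOn (fun g => fun x : {x : Fin n → Bool // x ∉ T} => g x.1)
  · intro g _; simp
  · intro g hg g' hg' h
    simp only [Finset.coe_filter, Finset.mem_univ, true_and, Set.mem_setOf_eq] at hg hg'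
    funext x
    by_cases hx : x ∈ T
    · rw [hg x hx, hg' x hx]
    · exact congr_fun h ⟨x, hx⟩

/-! ## §2 Codes of small circuits: count, constants, and shallow protocols -/

/-- Riordan–Shannon in exponent form: `#Code(n,S) ≤ 2^{(2n+4)(S+1)}` as soon as `n + S + 1 ≤ 2^n`
(from the tree's `CircuitCount.card_code_le`). -/
theorem card_code_le_two_pow {S : ℕ} (hM : n + S + 1 ≤ 2 ^ n) :
    Fintype.card (CircuitCount.Code n S) ≤ 2 ^ ((2 * n + 4) * (S + 1)) := by
  set M := n + S + 1 with hM'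
  have h16 : (S + 1) * M ≤ 16 * M ^ 2 := by nlinarith
  have hcard : Fintype.card (CircuitCount.Code n S) ≤ (16 * M ^ 2) ^ (S + 1) := by
    calc Fintype.card (CircuitCount.Code n S)
        ≤ (S + 1) * (16 * M ^ 2) ^ S * M := CircuitCount.card_code_le n S
      _ = (16 * M ^ 2) ^ S * ((S + 1) * M) := by ring
      _ ≤ (16 * M ^ 2) ^ S * (16 * M ^ 2) := Nat.mul_le_mul_left _ h16
      _ = (16 * M ^ 2) ^ (S + 1) := by ring
  have h16M : 16 * M ^ 2 ≤ 2 ^ (2 * n + 4) := by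
    have : 2 ^ (2 * n + 4) = 16 * (2 ^ n) ^ 2 := by ring
    rw [this]
    gcongr
  calc Fintype.card (CircuitCount.Code n S) ≤ (16 * M ^ 2) ^ (S + 1) := hcard
    _ ≤ (2 ^ (2 * n + 4)) ^ (S + 1) := Nat.pow_le_pow_left h16M _
    _ = 2 ^ ((2 * n + 4) * (S + 1)) := by rw [← pow_mul]

/-- Constants are decodings of codes of every size `≥ 1` (one arity-`0` gate). -/
theorem exists_code_const {S : ℕ} (hS : 1 ≤ S) (b : Bool) :
    ∃ c : CircuitCount.Code n S, ∀ x, CircuitCount.decode c x = b := by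
  obtain ⟨C, hO, hsize, hev⟩ := (cktSize_const (Fin n) b).toCircuit
  obtain ⟨c, hc⟩ := CircuitCount.exists_code (s := S) C hO (hsize.trans hS)
  exact ⟨c, fun x => by rw [hc, hev]⟩

/-- Karchmer–Wigderson, easy direction, in code form: a protocol of depth `d` solving a rectangle `A × B` with
both sides inhabited is separated (`1` on `A`, `0` on `B`) by the decoding of a code of any size `S ≥ 2^{d+1} − 1`
(the tree's `KWTree.exists_cktSize_of_rectangle`, `CktSize.toCircuit`, `CircuitCount.exists_code`). -/
theorem exists_code_of_solvesRect {S : ℕ} (Q : KWTree (Fin n)) {A B : Set (Fin n → Bool)}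
    (hA : A.Nonempty) (hB : B.Nonempty) (hQ : SolvesRect Q A B) (hS : 2 ^ (Q.depth + 1) ≤ S + 1) :
    ∃ c : CircuitCount.Code n S, (∀ a ∈ A, CircuitCount.decode c a = true) ∧
      (∀ b ∈ B, CircuitCount.decode c b = false) := by
  obtain ⟨F, s, hF, hs, hT, hf⟩ := Q.exists_cktSize_of_rectangle A B hA hB hQ
  obtain ⟨C, hO, hsize, hev⟩ := hF.toCircuit
  obtain ⟨c, hc⟩ := CircuitCount.exists_code (s := S) C hO (by omega)
  exact ⟨c, fun a ha => by rw [hc, hev]; exact hT a ha, fun b hb => by rw [hc, hev]; exact hf b hb⟩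

/-! ## §3 The bad set: functions that agree with a small code on a satisfiable subspace -/

/-- One PIECE of the bad set — functions agreeing with a fixed `h` on the solution set of a fixed satisfiable
system of `k` equations — has at most `2^{2^n − 2^{n−k}}` elements. -/
theorem card_piece_le (k : ℕ) (σ : Fin k → Finset (Fin n) × Bool) (h : (Fin n → Bool) → Bool)
    (X : Finset ((Fin n → Bool) → Bool))
    (hX : ∀ g ∈ X, (∃ x, ∀ e ∈ List.ofFn σ, rowParity e.1 x = e.2) ∧
      ∀ x, (∀ e ∈ List.ofFn σ, rowParity e.1 x = e.2) → g x = h x) :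
    X.card ≤ 2 ^ (2 ^ n - 2 ^ (n - k)) := by
  rcases X.eq_empty_or_nonempty with hX0 | ⟨g₀, hg₀⟩
  · rw [hX0]; simp
  · have hσ := (hX g₀ hg₀).1
    set T := Finset.univ.filter (fun x : Fin n → Bool => ∀ e ∈ List.ofFn σ, rowParity e.1 x = e.2) with hT
    have hTc : 2 ^ (n - (List.ofFn σ).length) ≤ T.card := two_pow_le_card_sol _ hσ
    rw [List.length_ofFn] at hTc
    calc X.card ≤ (Finset.univ.filter fun g : (Fin n → Bool) → Bool => ∀ x ∈ T, g x = h x).card := by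
          apply Finset.card_le_card
          intro g hg
          simp only [Finset.mem_filter, Finset.mem_univ, true_and, hT]
          intro x hx
          exact (hX g hg).2 x hx
      _ ≤ 2 ^ (2 ^ n - T.card) := card_agreeOn_le T h
      _ ≤ 2 ^ (2 ^ n - 2 ^ (n - k)) := Nat.pow_le_pow_right (by norm_num) (by omega)

/-- One LEVEL of the bad set — functions agreeing, on the solution set of SOME satisfiable system of `k`
equations, with the decoding of SOME code of size `2^{q−k}` — has at most `2^{2^n − n − 1}` elements, given the
key exponent inequality (union bound over the `2^{(n+1)k}` systems and the `≤ 2^{(2n+4)(2^{q−k}+1)}` codes). -/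
theorem card_level_le {q k : ℕ}
    (hkey : (n + 1) * k + (2 * n + 4) * (2 ^ (q - k) + 1) + n + 1 ≤ 2 ^ (n - k))
    (hM : n + 2 ^ (q - k) + 1 ≤ 2 ^ n) (Y : Finset ((Fin n → Bool) → Bool))
    (hY : ∀ g ∈ Y, ∃ (σ : Fin k → Finset (Fin n) × Bool) (c : CircuitCount.Code n (2 ^ (q - k))),
      (∃ x, ∀ e ∈ List.ofFn σ, rowParity e.1 x = e.2) ∧
        ∀ x, (∀ e ∈ List.ofFn σ, rowParity e.1 x = e.2) → g x = CircuitCount.decode c x) :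
    Y.card ≤ 2 ^ (2 ^ n - n - 1) := by
  classical
  have hcardσ : Fintype.card (Fin k → Finset (Fin n) × Bool) = 2 ^ ((n + 1) * k) := by
    rw [Fintype.card_fun, Fintype.card_prod, Fintype.card_finset, Fintype.card_bool,
      Fintype.card_fin, Fintype.card_fin, ← pow_succ, ← pow_mul]
  have hcode : Fintype.card (CircuitCount.Code n (2 ^ (q - k))) ≤ 2 ^ ((2 * n + 4) * (2 ^ (q - k) + 1)) :=
    card_code_le_two_pow hM
  have h1 : 2 ^ (n - k) ≤ 2 ^ n := Nat.pow_le_pow_right (by norm_num) (by omega)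
  have hcover : Y ⊆ (Finset.univ : Finset (Fin k → Finset (Fin n) × Bool)).biUnion fun σ =>
      (Finset.univ : Finset (CircuitCount.Code n (2 ^ (q - k)))).biUnion fun c =>
        Y.filter fun g => (∃ x, ∀ e ∈ List.ofFn σ, rowParity e.1 x = e.2) ∧
          ∀ x, (∀ e ∈ List.ofFn σ, rowParity e.1 x = e.2) → g x = CircuitCount.decode c x := by
    intro g hg
    obtain ⟨σ, c, hsat, hagree⟩ := hY g hg
    exact Finset.mem_biUnion.2 ⟨σ, Finset.mem_univ _, Finset.mem_biUnion.2 ⟨c, Finset.mem_univ _,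
      Finset.mem_filter.2 ⟨hg, hsat, hagree⟩⟩⟩
  calc Y.card ≤ _ := Finset.card_le_card hcover
    _ ≤ ∑ σ : Fin k → Finset (Fin n) × Bool, ∑ c : CircuitCount.Code n (2 ^ (q - k)),
          2 ^ (2 ^ n - 2 ^ (n - k)) := by
        refine Finset.card_biUnion_le.trans (Finset.sum_le_sum fun σ _ => ?_)
        refine Finset.card_biUnion_le.trans (Finset.sum_le_sum fun c _ => ?_)
        exact card_piece_le k σ (CircuitCount.decode c) _ fun g hg => (Finset.mem_filter.1 hg).2
    _ = Fintype.card (Fin k → Finset (Fin n) × Bool) *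
          (Fintype.card (CircuitCount.Code n (2 ^ (q - k))) * 2 ^ (2 ^ n - 2 ^ (n - k))) := by
        simp only [Finset.sum_const, smul_eq_mul, Finset.card_univ]
    _ ≤ 2 ^ ((n + 1) * k) * (2 ^ ((2 * n + 4) * (2 ^ (q - k) + 1)) * 2 ^ (2 ^ n - 2 ^ (n - k))) := by
        rw [hcardσ]
        exact Nat.mul_le_mul_left _ (Nat.mul_le_mul_right _ hcode)
    _ = 2 ^ ((n + 1) * k + (2 * n + 4) * (2 ^ (q - k) + 1) + (2 ^ n - 2 ^ (n - k))) := by ring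
    _ ≤ 2 ^ (2 ^ n - n - 1) := Nat.pow_le_pow_right (by norm_num) (by omega)

/-- **The good function.**  Under the exponent inequalities (levels `k = 0, …, q` together have fewer than
`(q+1) 2^{2^n−n−1} < 2^{2^n}` elements) there is a `g : {0,1}^n → {0,1}` that differs, inside the solution set of
EVERY satisfiable system of `k ≤ q` parity equations, from the decoding of EVERY code of size `2^{q−k}`. -/
theorem exists_subspaceGood {q : ℕ} (hq : q + 1 ≤ n)
    (hkey : ∀ k ≤ q, (n + 1) * k + (2 * n + 4) * (2 ^ (q - k) + 1) + n + 1 ≤ 2 ^ (n - k))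
    (hM : ∀ k ≤ q, n + 2 ^ (q - k) + 1 ≤ 2 ^ n) :
    ∃ g : (Fin n → Bool) → Bool, ∀ k ≤ q, ∀ (σ : Fin k → Finset (Fin n) × Bool)
      (c : CircuitCount.Code n (2 ^ (q - k))),
      (∃ x, ∀ e ∈ List.ofFn σ, rowParity e.1 x = e.2) →
      ∃ x, (∀ e ∈ List.ofFn σ, rowParity e.1 x = e.2) ∧ g x ≠ CircuitCount.decode c x := by
  classical
  by_contra hcon
  push Not at hcon
  have hcover : (Finset.univ : Finset ((Fin n → Bool) → Bool)) ⊆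
      (Finset.range (q + 1)).biUnion fun k => Finset.univ.filter fun g : (Fin n → Bool) → Bool =>
        ∃ (σ : Fin k → Finset (Fin n) × Bool) (c : CircuitCount.Code n (2 ^ (q - k))),
          (∃ x, ∀ e ∈ List.ofFn σ, rowParity e.1 x = e.2) ∧
            ∀ x, (∀ e ∈ List.ofFn σ, rowParity e.1 x = e.2) → g x = CircuitCount.decode c x := by
    intro g _
    obtain ⟨k, hk, σ, c, hsat, hagree⟩ := hcon g
    exact Finset.mem_biUnion.2 ⟨k, Finset.mem_range.2 (by omega),
      Finset.mem_filter.2 ⟨Finset.mem_univ _, σ, c, hsat, hagree⟩⟩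
  have huniv : (Finset.univ : Finset ((Fin n → Bool) → Bool)).card = 2 ^ (2 ^ n) := by
    simp [Finset.card_univ, Fintype.card_bool, Fintype.card_fin]
  have hn2 : n < 2 ^ n := Nat.lt_two_pow_self
  have hlt : (Finset.univ : Finset ((Fin n → Bool) → Bool)).card < 2 ^ (2 ^ n) :=
    calc _ ≤ _ := Finset.card_le_card hcover
      _ ≤ ∑ k ∈ Finset.range (q + 1), 2 ^ (2 ^ n - n - 1) := by
          refine Finset.card_biUnion_le.trans (Finset.sum_le_sum fun k hk => ?_)
          have hk' : k ≤ q := by rw [Finset.mem_range] at hk; omega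
          exact card_level_le (hkey k hk') (hM k hk') _ fun g hg => (Finset.mem_filter.1 hg).2
      _ = (q + 1) * 2 ^ (2 ^ n - n - 1) := by rw [Finset.sum_const, Finset.card_range, smul_eq_mul]
      _ < 2 ^ (n + 1) * 2 ^ (2 ^ n - n - 1) := by
          apply Nat.mul_lt_mul_of_pos_right ?_ (by positivity)
          calc q + 1 ≤ n := hq
            _ < 2 ^ n := hn2
            _ ≤ 2 ^ (n + 1) := Nat.pow_le_pow_right (by norm_num) (by omega)
      _ = 2 ^ (2 ^ n) := by rw [← pow_add]; congr 1; omega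
  omega

/-! ## §4 Exponent arithmetic for the constant `c = 3` -/

/-- `n + 1 ≤ 2^{n−1}` for `n ≥ 3`. -/
theorem succ_le_two_pow_pred (hn : 3 ≤ n) : n + 1 ≤ 2 ^ (n - 1) := by
  induction n, hn using Nat.le_induction with
  | base => norm_num
  | succ m hm ih =>
    have : 2 ^ (m + 1 - 1) = 2 * 2 ^ (m - 1) := by
      rw [← pow_succ']; congr 1; omega
    omega

/-- The size bound `n + 2^{q−k} + 1 ≤ 2^n` behind the code count (`n ≥ 4`, `q ≤ n − 1`). -/
theorem size_le_two_pow {q k : ℕ} (hn : 4 ≤ n) (hq : q + 1 ≤ n) : n + 2 ^ (q - k) + 1 ≤ 2 ^ n := by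
  have h1 : n + 1 ≤ 2 ^ (n - 1) := succ_le_two_pow_pred (by omega)
  have h2 : 2 ^ (q - k) ≤ 2 ^ (n - 1) := Nat.pow_le_pow_right (by norm_num) (by omega)
  have h3 : 2 ^ n = 2 * 2 ^ (n - 1) := by rw [← pow_succ']; congr 1; omega
  omega

/-- **The key exponent inequality** for `r = 3 (log₂ n + 1)`, `q = n − r − 1`, `k ≤ q`:
`(n+1) k + (2n+4) (2^{q−k} + 1) + n + 1 ≤ 2^{n−k}` — because `(n+1)(n+2) + 2 ≤ 2^{2 log₂ n + 3}` and
`n − k = (q − k) + r + 1 ≥ (q − k) + 2 log₂ n + 4`. -/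
theorem key_ineq {k : ℕ} (hn : 3 * (Nat.log 2 n + 1) + 1 ≤ n) (hk : k ≤ n - 3 * (Nat.log 2 n + 1) - 1) :
    (n + 1) * k + (2 * n + 4) * (2 ^ (n - 3 * (Nat.log 2 n + 1) - 1 - k) + 1) + n + 1 ≤ 2 ^ (n - k) := by
  set L := Nat.log 2 n with hL
  have hlog : n < 2 ^ (L + 1) := Nat.lt_pow_succ_log_self one_lt_two n
  set P := 2 ^ (L + 1) with hP
  have hP2 : 2 ≤ P := by
    calc (2 : ℕ) = 2 ^ 1 := by norm_num
      _ ≤ 2 ^ (L + 1) := Nat.pow_le_pow_right (by norm_num) (by omega)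
  set A := 2 ^ (2 * L + 3) with hA
  have hA2 : A = 2 * (P * P) := by
    rw [hA, hP, ← pow_add, ← pow_succ']; congr 1; omega
  -- the polynomial part: `(n+1)(n+2) + 2 ≤ A`
  have hn1 : n + 1 ≤ P := hlog
  have e1 : (n + 1) * (n + 2) ≤ P * (P + 1) := Nat.mul_le_mul hn1 (by omega)
  have e2 : 2 * P ≤ P * P := Nat.mul_le_mul_right P hP2
  have e3 : P * (P + 1) = P * P + P := by ring
  have hnA : (n + 1) * (n + 2) + 2 ≤ A := by rw [hA2]; omega
  have e4 : (n + 1) * (k + 2) ≤ (n + 1) * (n - 2) := Nat.mul_le_mul_left (n + 1) (by omega)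
  have e5 : (n + 1) * (k + 2) = (n + 1) * k + (2 * n + 2) := by ring
  have e6 : (n + 1) * (n - 2) + (n + 1) * 4 = (n + 1) * (n + 2) := by
    rw [← Nat.mul_add]; congr 1; omega
  have e7 : (n + 1) * 2 ≤ (n + 1) * (n + 2) := Nat.mul_le_mul_left (n + 1) (by omega)
  have h2n4 : 2 * n + 4 ≤ A := by omega
  have hpoly : (n + 1) * k + (3 * n + 5) ≤ A := by omega
  -- the power of two on the right: `2 A 2^{q-k} ≤ 2^{n-k}`
  set j := n - 3 * (L + 1) - 1 - k with hj
  set B := 2 ^ j with hB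
  have hB1 : 1 ≤ B := Nat.one_le_two_pow
  have hpow : 2 * A * B ≤ 2 ^ (n - k) := by
    rw [hA, hB, ← pow_succ', ← pow_add]
    exact Nat.pow_le_pow_right (by norm_num) (by omega)
  have h3 : (2 * n + 4) * B ≤ A * B := Nat.mul_le_mul_right B h2n4
  have h4 : A ≤ A * B := Nat.le_mul_of_pos_right A hB1
  have hexp : (n + 1) * k + (2 * n + 4) * (B + 1) + n + 1 =
      ((n + 1) * k + (3 * n + 5)) + (2 * n + 4) * B := by ring
  rw [hexp]
  calc (n + 1) * k + (3 * n + 5) + (2 * n + 4) * B ≤ A + A * B := Nat.add_le_add hpoly h3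
    _ ≤ A * B + A * B := Nat.add_le_add_right h4 _
    _ = 2 * A * B := by ring
    _ ≤ 2 ^ (n - k) := hpow

/-! ## §5 S0⁺ -/

/-- **S0⁺ (`stub_jointSubspaceHard`).**  With `c = 3`: for every `n` with `3 (log₂ n + 1) + 1 ≤ n` there is
ONE `g : {0,1}^n → {0,1}` which is `3 (log₂ n + 1)`-affine-generic AND subspace-hard with budget
`q = n − 3 (log₂ n + 1) − 1` — the good function of `exists_subspaceGood`: a constant is the decoding of a
code of size `1 ≤ 2^{q−k}` (genericity), and a protocol of depth `< q − k` for the game of `g` restricted to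
the solution set of `k` equations is the decoding of a code of size `≤ 2^{q−k} − 1` agreeing with `g` there
(hardness). -/
theorem stub_jointSubspaceHard : jointSubspaceHard_exists := by
  refine ⟨3, fun n hn => ?_⟩
  have hqn : n - 3 * (Nat.log 2 n + 1) - 1 + 1 ≤ n := by omega
  have hkey : ∀ k ≤ n - 3 * (Nat.log 2 n + 1) - 1,
      (n + 1) * k + (2 * n + 4) * (2 ^ (n - 3 * (Nat.log 2 n + 1) - 1 - k) + 1) + n + 1 ≤ 2 ^ (n - k) :=
    fun k hk => key_ineq hn hk
  have hM : ∀ k ≤ n - 3 * (Nat.log 2 n + 1) - 1,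
      n + 2 ^ (n - 3 * (Nat.log 2 n + 1) - 1 - k) + 1 ≤ 2 ^ n :=
    fun k _ => size_le_two_pow (by omega) hqn
  obtain ⟨g, hg⟩ := exists_subspaceGood hqn hkey hM
  have hgen : AffGeneric g (3 * (Nat.log 2 n + 1)) := by
    intro E hE hsat β
    have hk : E.length ≤ n - 3 * (Nat.log 2 n + 1) - 1 := by omega
    obtain ⟨c, hc⟩ := exists_code_const (n := n)
      (S := 2 ^ (n - 3 * (Nat.log 2 n + 1) - 1 - E.length)) Nat.one_le_two_pow (!β)
    obtain ⟨x, hx, hne⟩ := hg E.length hk E.get c (by rw [List.ofFn_get]; exact hsat)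
    rw [List.ofFn_get] at hx
    refine ⟨x, hx, ?_⟩
    rw [hc] at hne
    revert hne
    cases g x <;> cases β <;> simp
  refine ⟨g, hgen, ?_⟩
  intro F hF hsat Q hQ
  by_contra hcon
  push Not at hcon
  have hFq : F.length + 3 * (Nat.log 2 n + 1) + 1 ≤ n := by omega
  obtain ⟨a, ha⟩ := hgen F hFq hsat true
  obtain ⟨b, hb⟩ := hgen F hFq hsat false
  have hS : 2 ^ (Q.depth + 1) ≤ 2 ^ (n - 3 * (Nat.log 2 n + 1) - 1 - F.length) + 1 :=
    (Nat.pow_le_pow_right (by norm_num) (by omega)).trans (Nat.le_succ _)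
  obtain ⟨c, hcA, hcB⟩ := exists_code_of_solvesRect Q ⟨a, ha⟩ ⟨b, hb⟩ hQ hS
  obtain ⟨x, hx, hne⟩ := hg F.length hF F.get c (by rw [List.ofFn_get]; exact hsat)
  rw [List.ofFn_get] at hx
  apply hne
  cases hgx : g x
  · exact (hcB x ⟨hx, hgx⟩).symm
  · exact (hcA x ⟨hx, hgx⟩).symm

end Summit.PneNP.PneNP.Theorems.KrwLrb
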